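import Summits.Ventures.CertifiedArithmetic.LowPrec.GemmThetaLawGenDefs

/-!
# The E3M2×E2M1 mixed all-precision law as `LawData`; levels `Q` and `top` checked

HONEST FRAMING (venture CertifiedArithmetic / cell `pub-lowprec`, seat gemm, gen 12 → 13): certified
error envelopes and provably optimal rounding/accumulation schemes for low-precision formats under
stated cost models; every table by two implementations; no hardware or vendor claims.

`e3m2e2m1Law` is the product alphabet E3M2 × E2M1 (grid `2^-5`, 143 signed letters, `x_max = 5376`)
with the second mixed law of paper `gemm.tex` Theorem t:thetapmix in the symbolic regime `M = 2048K`,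
`K ≥ 2`, i.e. EVERY `p ≥ 13`.  The check `LawData.lawCheck` (15,042 classes, the design aid's
count) is split by level over this file (`Q`, `top`, side conditions) and
`GemmThetaLawGenMixBCheck1..6.lean` (binades 0…12); `GemmThetaLawGenMixB.lean` assembles
`lawCheck_e3m2e2m1`.  Executable half of the certificate; the soundness layer is gen 13's.
-/

namespace Literature.ComputerArithmetic.FloatingPoint

namespace MiniFloat

namespace ThetaLaw

/-- E3M2 × E2M1 products (grid `2^-5`) with the law of gemm.tex Thm t:thetapmix (second mixed row):
`B = (2,3,4,5,6,8,12,20,36,68,132,260,516)`, `S = (2,2,2,2,4,8,16,32,64,128,256,512,1024)`, `J = 12`,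
`θ = (65M + 128)/512 = 65·2^(p-10) + 1/4`, `κ = 2048/(260M + 512)`, `ρ = 7/2`, `β_pair = 23/2`;
symbolic regime `M = 2048K`, `K ≥ 2` (every `p ≥ 13`; regime floor `2M > x_max = 5376`).
[cell, laws.py] -/
def e3m2e2m1Law : LawData :=
  { X := [
      1, 2, 3, 4, 5, 6, 7, 8, 9, 10, 12, 14, 15, 16, 18, 20, 21, 24, 28, 30, 32, 36, 40, 42, 48,
      56, 60, 64, 72, 80, 84, 96, 112, 120, 128, 144, 160, 168, 192, 224, 240, 256, 288, 320,
      336, 384, 448, 480, 512, 576, 640, 672, 768, 896, 960, 1024, 1152, 1280, 1344, 1536, 1792,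
      1920, 2048, 2304, 2560, 2688, 3072, 3584, 3840, 4608, 5376],
    J := 12, B := [2, 3, 4, 5, 6, 8, 12, 20, 36, 68, 132, 260, 516],
    S := [2, 2, 2, 2, 4, 8, 16, 32, 64, 128, 256, 512, 1024],
    th1 := 65, th0 := 128, thD := 512, kb := 11, rhoN := 7, rhoD := 2, betaN := 23, betaD := 2,
    M0 := 2048, K0 := 2, fixed := false }

/-- Side conditions of the E3M2×E2M1 regime. [cell, kernel] -/
theorem sideOK_e3m2e2m1 : e3m2e2m1Law.sideOK = true := by
  decide +kernel

/-- Level `Q` of the E3M2×E2M1 law check passes (1410 classes, both signs, all 143 letters).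
[cell, kernel `decide`] -/
theorem levCheck_e3m2e2m1_Q : e3m2e2m1Law.levCheck (Lev.Q) = true := by
  decide +kernel

/-- Level `top` of the E3M2×E2M1 law check passes (286 classes, both signs, all 143 letters).
[cell, kernel `decide`] -/
theorem levCheck_e3m2e2m1_top : e3m2e2m1Law.levCheck (Lev.top) = true := by
  decide +kernel

end ThetaLaw

end MiniFloat

end Literature.ComputerArithmetic.FloatingPoint
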